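import Summits.Langlands.Langlands.Theses.EisensteinGelfandKirillov
import Literature.NumberTheory.GaloisRepresentations.GaloisRepFrobeniusProofs
import Literature.NumberTheory.Automorphic.ThorneQInfinityModular
import Literature.NumberTheory.Automorphic.GLnAdelicStructureProofs
import HarnessLib

/-!
# Sketch — crux idea `eisenstein-entry` for stmt-Langlands-18275
`Summit.Langlands.Langlands.Theses.EisensteinGelfandKirillov.SectorComplement`
(`ReducibleCrystallineModular → _root_.Langlands`), crux-ideate round 1, ideator 1.

First lemma of the card, PROVED: the route target `X = ReducibleCrystallineModular` discharges weak
automorphy (the certified leaf `B_w` of the summit partition W / B_w / LGC / AC) not only on its own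
sector `Σ_X` but on the whole EISENSTEIN REGION `R(X)` = every `ℓ`-adic `ρ : Γ_K → GL₂(ℚ̄_ℓ)` (any
prime `ℓ`, any `ι`, any residual image) that is a COMPANION — same complex Frobenius polynomials at
almost all places — of some `p`-adic member `ρ_p ∈ Σ_X`.  The transport is pure polynomial algebra
(`Polynomial.map` along `ι⁻¹` is injective); no irreducibility or geometricity of `ρ` is needed.
Then the cut of `B_w` along the region and its glue (case split), so that a line for the crux reads
`W → B_w^{off R(X)} → LGC → AC (2.2) → AC (2.3) → SectorComplement` with `X` consumed on `R(X)`.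
-/

noncomputable section

set_option linter.dupNamespace false

open scoped NumberField Classical Polynomial
open Filter IsDedekindDomain Polynomial
open Literature.NumberTheory.Automorphic Literature.NumberTheory.GaloisRepresentations
open Summit.Langlands
open Summit.Langlands.Langlands.Theses.EisensteinGelfandKirillov (ReducibleCrystallineModular
  SectorComplement)

namespace Summit.Langlands.Langlands.Cruxes.SectorComplement.EisensteinEntry

/-! ## 0. The sector `Σ_X` and the Eisenstein region `R(X)` -/

/-- `ρ_p ∈ Σ_X`: VERBATIM the hypotheses of the route target `ReducibleCrystallineModular` on a
`p`-adic `ρ_p : Γ_K → GL₂(ℚ̄_p)` — `K` totally real, `p ≥ 5` unramified in `K`, `ρ_p` irreducible,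
totally odd, unramified a.e., with an upper-triangular integral model over the valuation ring of
`ℚ̄_p` that is `p`-distinguished at every `v ∣ p`, crystalline (Fontaine's pinned datum) with
pairwise distinct labelled Hodge–Tate weights at every `v ∣ p`.  [cite: SkinnerWiles1999, Thm. A] -/
def InSector (K : Type) [Field K] [NumberField K] (p : ℕ) [Fact p.Prime]
    (ρp : FramedGaloisRep K (PadicAlgCl p) 2) : Prop :=
  NumberField.IsTotallyReal K ∧ 5 ≤ p ∧ ¬ ((p : ℤ) ∣ NumberField.discr K) ∧
    ρp.toGaloisRep.IsIrreducible ∧ ρp.IsOdd ∧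
    (∀ᶠ v : HeightOneSpectrum (𝓞 K) in cofinite, ρp.IsUnramifiedAt v) ∧
    ∃ (O : ValuationSubring (PadicAlgCl p))
      (_ : O = (Valued.v : Valuation (PadicAlgCl p) NNReal).valuationSubring)
      (ρ₀ : Field.absoluteGaloisGroup K →* Matrix.GeneralLinearGroup (Fin 2) O),
      ρp.HasUpperTriangularIntegralModel ρ₀ ∧
      ∀ (v : HeightOneSpectrum (𝓞 K)) (hv : ((p : ℕ) : 𝓞 K) ∈ v.asIdeal),
        IsPDistinguishedAt ρ₀ v ∧
        (Literature.NumberTheory.PAdicHodge.fontainePstAdicCompletion v p hv).IsCrystallineFramed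
          (ρp.toLocal v) ∧
        (letI := (Literature.NumberTheory.PAdicHodge.fontainePstAdicCompletion v p hv).algebra
         GaloisRep.IsLabelledHodgeTateRegular
          (Literature.NumberTheory.PAdicHodge.fontainePstAdicCompletion v p hv).𝔅
          (ρp.toLocal v).toGaloisRep)

/-- `ρ` (ℓ-adic, read through `ι`) and `ρ_p` (p-adic, read through `ι_p`) are COMPANIONS: at
almost all places both are unramified-compatible with ONE complex polynomial (Serre Ch. I §2.3;
Taylor 2004 Conj. 3; the clause of `ReciprocityUpToIrreducibility`'s `AutomorphyAtOnePrime`).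
[cite: SerreAbelianLadic1968, Ch. I §2.3] -/
def IsCompanion {K : Type} [Field K] [NumberField K] {ℓ p : ℕ} [Fact ℓ.Prime] [Fact p.Prime]
    (ι : PadicAlgCl ℓ ≃+* ℂ) (ιp : PadicAlgCl p ≃+* ℂ) (ρ : FramedGaloisRep K (PadicAlgCl ℓ) 2)
    (ρp : FramedGaloisRep K (PadicAlgCl p) 2) : Prop :=
  ∀ᶠ v : HeightOneSpectrum (𝓞 K) in cofinite, ρ.IsUnramifiedAt v ∧
    ∃ P : Polynomial ℂ, ρ.HasFrobCharpolyAt v (P.map (ι.symm : ℂ →+* PadicAlgCl ℓ)) ∧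
      ρp.HasFrobCharpolyAt v (P.map (ιp.symm : ℂ →+* PadicAlgCl p))

/-- The EISENSTEIN REGION `R(X)`: `ρ` has a companion in the sector `Σ_X` at SOME prime `p`. -/
def InEisensteinRegion (K : Type) [Field K] [NumberField K] (ℓ : ℕ) [Fact ℓ.Prime]
    (ι : PadicAlgCl ℓ ≃+* ℂ) (ρ : FramedGaloisRep K (PadicAlgCl ℓ) 2) : Prop :=
  ∃ (p : ℕ) (_ : Fact p.Prime) (ιp : PadicAlgCl p ≃+* ℂ) (ρp : FramedGaloisRep K (PadicAlgCl p) 2),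
    InSector K p ρp ∧ IsCompanion ι ιp ρ ρp

/-- **Weak automorphy on the Eisenstein region** — the typed bite of `B_w` claimed by the card:
every rank-2 `ρ` over a number field `K` with a `Σ_X`-companion is Satake–Frobenius compatible a.e.
with an L-algebraic cuspidal `π` of `GL₂(𝔸_K)` (NO hypothesis on `ρ` itself: any prime `ℓ`, any
residual image, any local behaviour at `ℓ`). -/
def EisensteinRegionAutomorphy : Prop :=
  ∀ (K : Type) [Field K] [NumberField K] (hcpt : isCompact_glFiniteIntegralLevel 2 K)
    (ℓ : ℕ) [Fact ℓ.Prime] (ι : PadicAlgCl ℓ ≃+* ℂ) (ρ : FramedGaloisRep K (PadicAlgCl ℓ) 2),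
    InEisensteinRegion K ℓ ι ρ →
      ∃ π : CuspidalAutomorphicRepData 2 K hcpt, π.1.IsLAlgebraic ∧
        ∀ᶠ v : HeightOneSpectrum (𝓞 K) in cofinite, SatakeFrobCompatibleAt ι π.1 ρ v

/-! ## 1. Transport algebra (re-derived here; landed as
`IrreducibleOffSector.arithFrobPolyOfSatake_one_eq_map` in Theorems/…IotaTransport) -/

/-- The complex Satake polynomial `∏_{a ∈ α} (X - a⁻¹)`. -/
def satakePolyC (α : Multiset ℂ) : Polynomial ℂ := (α.map fun a => X - C a⁻¹).prod

theorem arithFrobPolyOfSatake_one_eq_map {ℓ : ℕ} [Fact ℓ.Prime] (ι : PadicAlgCl ℓ ≃+* ℂ)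
    (q : ℕ) (α : Multiset ℂ) :
    arithFrobPolyOfSatake ι q 1 α = (satakePolyC α).map (ι.symm : ℂ →+* PadicAlgCl ℓ) := by
  rw [arithFrobPolyOfSatake_one, satakePolyC, Polynomial.map_multiset_prod, Multiset.map_map]
  congr 1
  refine Multiset.map_congr rfl fun a _ => ?_
  simp [Polynomial.map_sub, Polynomial.map_X, Polynomial.map_C]

/-- A complex polynomial read by `ρ` through `ι` at `v` IS the Satake polynomial of any `π`
compatible with `ρ` at `v` (uniqueness of Frobenius polynomials + injectivity of `map ι⁻¹`). -/
theorem eq_satakePolyC_of_hasFrobCharpolyAt {K : Type} [Field K] [NumberField K] {ℓ : ℕ}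
    [Fact ℓ.Prime] (ι : PadicAlgCl ℓ ≃+* ℂ) {n : ℕ} {ρ : FramedGaloisRep K (PadicAlgCl ℓ) n}
    {v : HeightOneSpectrum (𝓞 K)} {α : Multiset ℂ} {P : Polynomial ℂ}
    (hα : ρ.HasFrobCharpolyAt v (arithFrobPolyOfSatake ι v.residueCard 1 α))
    (hP : ρ.HasFrobCharpolyAt v (P.map (ι.symm : ℂ →+* PadicAlgCl ℓ))) : P = satakePolyC α := by
  have h1 : P.map (ι.symm : ℂ →+* PadicAlgCl ℓ) = arithFrobPolyOfSatake ι v.residueCard 1 α :=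
    GaloisRep.HasFrobCharpolyAt.unique_holds
      ((FramedGaloisRep.hasFrobCharpolyAt_toGaloisRep_iff v _ ρ).mpr hP)
      ((FramedGaloisRep.hasFrobCharpolyAt_toGaloisRep_iff v _ ρ).mpr hα)
  rw [arithFrobPolyOfSatake_one_eq_map] at h1
  exact Polynomial.map_injective _ ι.symm.injective h1

/-! ## 2. FIRST LEMMA (proved): `X` discharges `B_w` on the whole Eisenstein region -/

/-- **Eisenstein entry.**  `ReducibleCrystallineModular → EisensteinRegionAutomorphy`: apply `X`
to the companion `ρ_p ∈ Σ_X`, then move the automorphic `π` from `(p, ι_p)` to `(ℓ, ι)` along the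
common complex Frobenius polynomials.  [cite: SerreAbelianLadic1968, Ch. I §2.3] -/
theorem eisensteinRegionAutomorphy_of_X (hX : ReducibleCrystallineModular) :
    EisensteinRegionAutomorphy := by
  intro K _ _ hcpt ℓ _ ι ρ hreg
  obtain ⟨p, hp, ιp, ρp, hsec, hcomp⟩ := hreg
  obtain ⟨hK, h5, hdisc, hirr, hodd, hur, O, hO, ρ₀, hup, hloc⟩ := hsec
  obtain ⟨π, hL, hπ⟩ := hX K hK p h5 hdisc O hO hcpt ιp ρp ρ₀ hirr hodd hur hup hloc
  refine ⟨π, hL, ?_⟩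
  filter_upwards [hπ, hcomp] with v hv hv'
  obtain ⟨α, hα, -, hcp⟩ := hv
  obtain ⟨hurρ, P, hPρ, hPp⟩ := hv'
  obtain rfl : P = satakePolyC α := eq_satakePolyC_of_hasFrobCharpolyAt ιp hcp hPp
  refine ⟨α, hα, hurρ, ?_⟩
  rwa [arithFrobPolyOfSatake_one_eq_map]

/-! ## 3. The cut of the certified leaf `B_w` along `R(X)` and its glue -/

/-- `B_w` — weak automorphy (Fontaine–Mazur–Langlands, a.e. form), VERBATIM the certified leaf
(`ReciprocityUpToIrreducibility` line `Sketch` / `CapacityClassicality.WeakAutomorphy`). -/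
def WeakAutomorphy : Prop :=
  ∀ (K : Type) [Field K] [NumberField K] (n : ℕ) (hcpt : isCompact_glFiniteIntegralLevel n K),
    0 < n → ∀ (ℓ : ℕ) [Fact ℓ.Prime] (ι : PadicAlgCl ℓ ≃+* ℂ) (ρ : FramedGaloisRep K (PadicAlgCl ℓ) n),
      ρ.toGaloisRep.IsIrreducible →
        ((∀ᶠ v : HeightOneSpectrum (𝓞 K) in cofinite, ρ.IsUnramifiedAt v) ∧
          ∀ (v : HeightOneSpectrum (𝓞 K)) (hv : ((ℓ : ℕ) : 𝓞 K) ∈ v.asIdeal),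
            (Literature.NumberTheory.PAdicHodge.fontainePstAdicCompletion v ℓ hv).IsDeRhamFramed
              (ρ.toLocal v)) →
        ∃ π : CuspidalAutomorphicRepData n K hcpt, π.1.IsLAlgebraic ∧
          ∀ᶠ v : HeightOneSpectrum (𝓞 K) in cofinite, SatakeFrobCompatibleAt ι π.1 ρ v

/-- The region predicate at arbitrary rank (rank 2 forced). -/
def InEisensteinRegionN (K : Type) [Field K] [NumberField K] (n : ℕ) (ℓ : ℕ) [Fact ℓ.Prime]
    (ι : PadicAlgCl ℓ ≃+* ℂ) (ρ : FramedGaloisRep K (PadicAlgCl ℓ) n) : Prop :=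
  ∃ h : n = 2, InEisensteinRegion K ℓ ι (h ▸ ρ)

/-- **B_w OFF the Eisenstein region** — the stub that stays open (summit-scale: all `n`, all `K`,
minus the rank-2 companions of `Σ_X`). [cite: FontaineMazurGeometric1995, Conj. 1] -/
def WeakAutomorphyOffEisenstein : Prop :=
  ∀ (K : Type) [Field K] [NumberField K] (n : ℕ) (hcpt : isCompact_glFiniteIntegralLevel n K),
    0 < n → ∀ (ℓ : ℕ) [Fact ℓ.Prime] (ι : PadicAlgCl ℓ ≃+* ℂ) (ρ : FramedGaloisRep K (PadicAlgCl ℓ) n),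
      ρ.toGaloisRep.IsIrreducible →
        ((∀ᶠ v : HeightOneSpectrum (𝓞 K) in cofinite, ρ.IsUnramifiedAt v) ∧
          ∀ (v : HeightOneSpectrum (𝓞 K)) (hv : ((ℓ : ℕ) : 𝓞 K) ∈ v.asIdeal),
            (Literature.NumberTheory.PAdicHodge.fontainePstAdicCompletion v ℓ hv).IsDeRhamFramed
              (ρ.toLocal v)) →
        ¬ InEisensteinRegionN K n ℓ ι ρ →
        ∃ π : CuspidalAutomorphicRepData n K hcpt, π.1.IsLAlgebraic ∧
          ∀ᶠ v : HeightOneSpectrum (𝓞 K) in cofinite, SatakeFrobCompatibleAt ι π.1 ρ v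

/-- **Glue of the cut** (case split on the region): `B_w` from the region theorem and the
off-region stub.  With `eisensteinRegionAutomorphy_of_X` this is `X → B_w^{off} → B_w`. -/
theorem weakAutomorphy_of_cut (hR : EisensteinRegionAutomorphy)
    (hoff : WeakAutomorphyOffEisenstein) : WeakAutomorphy := by
  intro K _ _ n hcpt hn ℓ _ ι ρ hirr hgeo
  by_cases hreg : InEisensteinRegionN K n ℓ ι ρ
  · obtain ⟨h, hreg⟩ := hreg
    subst h
    exact hR K hcpt ℓ ι ρ hreg
  · exact hoff K n hcpt hn ℓ ι ρ hirr hgeo hreg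

/-- The composed first step of the line: `X → B_w^{off R(X)} → B_w`. -/
theorem weakAutomorphy_of_X_of_off (hX : ReducibleCrystallineModular)
    (hoff : WeakAutomorphyOffEisenstein) : WeakAutomorphy :=
  weakAutomorphy_of_cut (eisensteinRegionAutomorphy_of_X hX) hoff


/-! ## 4. A populated corner of `R(X)` in tree vocabulary: elliptic curves with good reduction above
an unramified `5` (X + Thorne 2019 Thm. 2 second alternative = Thorne 2016 Thm. 7.6) -/

section Elliptic

open Literature.NumberTheory.Automorphic (IsModularEllipticCurve Thorne2019_thm2_five
  isCompact_glFiniteIntegralLevel_holds)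

instance factPrimeFive : Fact (Nat.Prime 5) := ⟨by norm_num⟩

/-- **Target corollary (support item P3 of the card).**  Over a totally real field `K` with
`5 ∤ disc K`, every elliptic curve — integral Weierstrass model `E / 𝓞 K`, `Δ(E) ≠ 0` — whose
discriminant is a unit at every place above `5` (good reduction above `5`) is modular in the sense
of Caraiani–Newton / FLS (`IsModularEllipticCurve`).  OPEN today for `[K:ℚ] ≥ 5` in general
(known: `[K:ℚ] ≤ 3`, FLS 2015 / DNS 2020; quartic `K ∌ √5`, Box 2022; irreducible `ρ̄_{E,5}`,
Thorne 2016 Thm. 7.6). [cite: Thorne2019, Thm. 2] [cite: FreitasLeHungSiksek2015, Thm. 7] -/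
def EllipticGoodAboveFive : Prop :=
  ∀ (K : Type) [Field K] [NumberField K], NumberField.IsTotallyReal K →
    ¬ ((5 : ℤ) ∣ NumberField.discr K) →
    ∀ E : WeierstrassCurve (𝓞 K), E.Δ ≠ 0 →
      (∀ v : HeightOneSpectrum (𝓞 K), ((5 : ℕ) : 𝓞 K) ∈ v.asIdeal → E.Δ ∉ v.asIdeal) →
        IsModularEllipticCurve K E

/-- `5 ∤ disc K ⇒ √5 ∉ K` (`ℚ(√5) ⊆ K` forces `5 ∣ disc ℚ(√5) ∣ disc K`). Bridge fact, S-sized.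
[folklore] -/
def FiveUnramifiedNotSquare : Prop :=
  ∀ (K : Type) [Field K] [NumberField K], ¬ ((5 : ℤ) ∣ NumberField.discr K) → ¬ IsSquare (5 : K)

/-- **The 5-adic Tate-module package at a REDUCIBLE residue** (the card's bridge facts, bundled as
one named hypothesis; each clause is a theorem in print): for `E / 𝓞 K` as in the corollary with
`ρ̄_{E,5}` REDUCIBLE (a `K`-rational `5`-isogeny), either `E` is already modular (geometric CM), or
the `5`-adic Tate module `ρ = ρ_{E,5} ⊗ ℚ̄_5` lies in the sector `Σ_X` — irreducible (Faltings +
no CM over a totally real field), totally odd (`det = ε`), unramified outside `5Δ`, upper-triangular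
integral model from the isogeny filtration, `5`-distinguished at `v ∣ 5` AUTOMATICALLY (good
reduction at an unramified `v`: inertia characters `{ω, 1}` ordinary / `{ω₂, ω₂⁵}` supersingular,
Serre 1972 §1), crystalline with labelled weights `{0,1}` — and any L-algebraic cuspidal `π`
Satake–Frobenius compatible with `ρ` a.e. makes `E` modular (half-twist `π ⊗ |det|^{1/2}` to weight
zero; `q_w^{1/2}(α+β) = a_w(E)`). [cite: Serre1972, §1.11–1.12] [cite: FreitasLeHungSiksek2015, §2] -/
def TateModulePackageFive : Prop :=
  ∀ (K : Type) [Field K] [NumberField K], NumberField.IsTotallyReal K →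
    ¬ ((5 : ℤ) ∣ NumberField.discr K) →
    ∀ E : WeierstrassCurve (𝓞 K), E.Δ ≠ 0 →
      (∀ v : HeightOneSpectrum (𝓞 K), ((5 : ℕ) : 𝓞 K) ∈ v.asIdeal → E.Δ ∉ v.asIdeal) →
      ¬ (E.baseChange K).HasIrreducibleModPGaloisRep 5 →
        IsModularEllipticCurve K E ∨
        ∃ (ι : PadicAlgCl 5 ≃+* ℂ) (ρ : FramedGaloisRep K (PadicAlgCl 5) 2), InSector K 5 ρ ∧
          ∀ (hcpt : isCompact_glFiniteIntegralLevel 2 K) (π : CuspidalAutomorphicRepData 2 K hcpt),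
            π.1.IsLAlgebraic →
              (∀ᶠ v : HeightOneSpectrum (𝓞 K) in cofinite, SatakeFrobCompatibleAt ι π.1 ρ v) →
                IsModularEllipticCurve K E

/-- **P3, PROVED modulo the three named inputs:** `X` + Thorne's irreducible-mod-5 theorem + the
Tate-module package ⇒ modularity of every elliptic curve with good reduction above an unramified 5
over every totally real field.  The case split is on (ir)reducibility of `ρ̄_{E,5}`; `X` is used
exactly in the reducible branch — the Eisenstein entry. [cite: Thorne2019, Thm. 2] -/
theorem ellipticGoodAboveFive_of (hX : ReducibleCrystallineModular) (hT : Thorne2019_thm2_five)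
    (hsq : FiveUnramifiedNotSquare) (hP : TateModulePackageFive) : EllipticGoodAboveFive := by
  intro K _ _ hK h5 E hΔ hgood
  by_cases hirr : (E.baseChange K).HasIrreducibleModPGaloisRep 5
  · exact hT K hK (hsq K h5) E hΔ hirr
  · rcases hP K hK h5 E hΔ hgood hirr with hmod | ⟨ι, ρ, hsec, hbridge⟩
    · exact hmod
    · obtain ⟨hK', h5', hdisc, hirrρ, hodd, hur, O, hO, ρ₀, hup, hloc⟩ := hsec
      have hcpt : isCompact_glFiniteIntegralLevel 2 K := isCompact_glFiniteIntegralLevel_holds 2 K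
      obtain ⟨π, hL, hπ⟩ := hX K hK' 5 h5' hdisc O hO hcpt ι ρ ρ₀ hirrρ hodd hur hup hloc
      exact hbridge hcpt π hL hπ

end Elliptic

end Summit.Langlands.Langlands.Cruxes.SectorComplement.EisensteinEntry

end
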